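import Summits.QuantumFields.YangMills.Theorems.BalabanUVNodesN15KingModelFullPropagatorRiemannWeighted

/-!
# BalabanUVNodes ∕ N15 — THE KING MODEL, PART 11b: THE WEIGHTED TWO-SPACING RATE OF KING'S FULL `A = 0` FLUCTUATION PROPAGATOR IN THE
# ROW-UNIFORM RIEMANN-SUM NORM — `N′^{−(d+1)}·Σ_{y′}|G^{η′}_{K+n}(x′, y′) − G^η_K(x, y)|·e^{+δ′|B(x) − B(y)|_M} ≤ C·(L^{−γ∕2})^K`
# for every weight rate `0 ≤ δ′ ≤ δ₁`, uniformly in `K`, `n`, the volume and the mass (Track A, DAG node N15 = NE2; FAN-OUT v1.1 §N15 s3)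

HONEST FRAMING.  Count-neutral kernel bookkeeping (cell `pub-ymgap`, seat `pub-ymgap-dag-n15-d` g8; `--supports stmt-QuantumFields-20292
--as helper` = K3⁗ `SpineGivenEndpointR13Sep`; lineage K3 19676 → K3′ 19908 → K3‴ 19912).  TEMPLATE LITERATURE, `A = 0`: C. King's scalar
U(1)-Higgs MODEL on finite tori ([King1986] §2.2 p. 653 (2.13)–(2.17), p. 654 (2.20), Prop. 3.8 (3.71) p. 664, §4 p. 675 (4.41)–(4.44)), NOT
Bałaban's covariant objects; NE2⁺ is NOT PRINTED for those and not proved here; NOT a node discharge; nothing continuum ∕ ℝ⁴ ∕ OS ∕ mass-gap ∕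
Clay.  0 `sorry`, 0 `def`, standard axioms.
THE POINT.  Part 10a's `fullProp_riemannRate_unif` (unweighted) fed the SUP two-spacing bound of the dressed minimiser (10b `kingHPot_step_le`).
For the DECAYING two-spacing bound (part 11c) the weighted version is needed: THIS FILE runs the paired peel induction of parts O-b∕10a with the
exponential weight `e^{δ′|B(x) − B(y)|_M}` on the blocks of the points UNDER `x′, y′`, carrying `∀ δ′ ∈ [0, δ₁]` inside the induction (one peel
divides the weight rate by `L`, part 11a `weight_peel_le`), paying `e^{δ₁} ≤ 2` per level (so that `L − e^{δ₁} ≥ 1` keeps the rate: `L^{−2}e^{δ₁}(A +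
X)θ^K ≤ Aθ^{K+1}` because `θ ≥ L^{−1}` and `A ≥ 2X`), absorbing the weight into part M's slice rate (`κ − δ₁ ≥ κ∕2`), base = part 11a's weighted mass
for the `(1+n)`-level run + [Ba 4] (1.10) at `δ_b∕2`:
* ★★ **`fullProp_riemannRateW_unif`** — `∃ δ₁ C > 0` (functions of `d, L, a, m₀², γ`; `0 ≤ γ ≤ 1`): for EVERY `0 ≤ δ′ ≤ δ₁`, `K, n ≥ 1`, cube
  `M_μ = 2L^e`, mass `0 < m² ≤ m₀²` and fine `x′` of the `(K+n)`-level run: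
  `N′^{−(d+1)}·Σ_{y′} |G^{η′}_{K+n}(x′, y′) − G^η_K(x, y)|·e^{δ′|B(x) − B(y)|_M} ≤ C·(L^{−γ∕2})^K` (`x, y` under `x′, y′`, King's pairing).
HONEST SCOPE.  As part 10a: `A = 0`, periodic b.c., odd `L ≥ 3`, `0 < m² ≤ m₀²`, cubes `2L^e`, lattice units, `K, n ≥ 1`; a (2.17)-summed
bookkeeping statement, not a printed proposition; nothing here is Bałaban's `G_k(U)`; not a discharge.
Locators: [King1986] C. King, CMP **102** (1986) 649–677: (2.13)–(2.17) p. 653, (2.20) p. 654, Theorem 3.3 (3.7) p. 658, Prop. 3.8 (3.71) p. 664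
and p. 664 (pairing `x′ ∈ B^n(x)`), (4.41)–(4.44) p. 675; [Ba 4] = [Balaban1983RegularityDecay] Theorem (1.10) p. 573.
-/

noncomputable section

namespace Summit.QuantumFields.YangMills.BalabanUVNodes.N15.KingModel

open Real Finset Matrix
open Literature.MathematicalPhysics.QuantumFieldTheory.Balaban1983to89 (Params)
open Literature.MathematicalPhysics.QuantumFieldTheory.Balaban1983to89.B4Sect5Proof (latticeConst latticeConst_nonneg)
open Literature.MathematicalPhysics.QuantumFieldTheory.Balaban1983to89.B5Prop11Plancherel (Tor fine)
open Literature.MathematicalPhysics.QuantumFieldTheory.King1986 (aK aK_pos)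
open Literature.MathematicalPhysics.QuantumFieldTheory.King1986.Torus (constrainedProp flatten blockOf tdistT torCongr site
  blockOf_flatten tdistT_nonneg tdistT_sumBound constrainedProp_decay_blocks_unif)
open Summit.QuantumFields.YangMills.BalabanUVNodes.N15KingModelRung.Curved (KSliceIdx ksM ksU ksSlice ksSlice' underPtN mul_tdistT_blockOf_le
  blockOf_underPtN fullProp_peel_pair_abs_le underPtN_flatten fine_assoc ksSlice_rate_unif)

variable {d : ℕ}

section RateW

variable (L : ℕ) [NeZero L]

/-- **THE WEIGHTED TWO-SPACING η-RATE OF KING'S FULL `A = 0` FLUCTUATION PROPAGATOR IN THE ROW-UNIFORM RIEMANN-SUM NORM**: for odd `L ≥ 3`,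
`a > 0`, a mass cap `m₀² ≥ 0` and `0 ≤ γ ≤ 1` there are `δ₁, C > 0` (functions of `d, L, a, m₀², γ`) such that for EVERY weight rate `0 ≤ δ′ ≤ δ₁`,
every `K, n ≥ 1`, cube `M_μ = 2L^e`, mass `0 < m² ≤ m₀²` and fine point `x′` of the `(K+n)`-level run:
`N′^{−(d+1)}·Σ_{y′} |G^{η′}_{K+n}(x′, y′) − G^η_K(x, y)|·e^{δ′·|B(x) − B(y)|_M} ≤ C·(L^{−γ∕2})^K` (`x, y` under `x′, y′`; both propagators King's
`constrainedProp` at the same mass in their own lattice units).  Paired induction on `K` with the weight rate quantified inside (module docstring).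
[cite: King1986, (2.13)–(2.17) p.653, (2.20) p.654, Prop. 3.8 (3.71) p.664, (4.41)–(4.43) p.675; Balaban1983RegularityDecay, Theorem (1.10) p.573] -/
theorem fullProp_riemannRateW_unif (hLodd : Odd L) (hL : 2 ≤ L) {a : ℝ} (ha : 0 < a) {m0sq : ℝ} (hm0 : 0 ≤ m0sq) {γ : ℝ}
    (hγ0 : 0 ≤ γ) (hγ1 : γ ≤ 1) :
    ∃ δ₁ C : ℝ, 0 < δ₁ ∧ 0 < C ∧ ∀ (K : ℕ), 1 ≤ K → ∀ (δ' : ℝ), 0 ≤ δ' → δ' ≤ δ₁ → ∀ (n : ℕ), 1 ≤ n →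
      ∀ (e : ℕ) (M : Fin (d + 1) → ℕ) [∀ μ, NeZero (M μ)], (∀ μ, M μ = 2 * L ^ e) →
      ∀ (msq : ℝ), 0 < msq → msq ≤ m0sq →
      ∀ x' : Tor (fine (L ^ n * L ^ K) M),
        ((((L ^ n * L ^ K : ℕ) : ℝ)) ^ (d + 1))⁻¹ *
            ∑ y', |constrainedProp (L ^ n * L ^ K) M (aK a L (K + n)) (((L ^ n * L ^ K : ℕ) : ℝ) ^ 2) msq x' y'
              - constrainedProp (L ^ K) M (aK a L K) (((L ^ K : ℕ) : ℝ) ^ 2) msq (underPtN L K n M x') (underPtN L K n M y')|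
              * Real.exp (δ' * tdistT M (blockOf (L ^ K) M (underPtN L K n M x')) (blockOf (L ^ K) M (underPtN L K n M y')))
          ≤ C * ((L : ℝ) ^ (-(γ / 2))) ^ K := by
  have hL1 : 1 < L := by omega
  have hL3 : 3 ≤ L := three_le_of_odd hLodd hL
  have hL1' : (1 : ℝ) ≤ L := by exact_mod_cast hL1.le
  have hL3r : (3 : ℝ) ≤ L := by exact_mod_cast hL3
  have hL0 : (0 : ℝ) < L := by positivity
  set θ : ℝ := (L : ℝ) ^ (-(γ / 2)) with hθdef
  have hθ0 : 0 < θ := Real.rpow_pos_of_pos hL0 _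
  have hθL : (L : ℝ)⁻¹ ≤ θ := by
    rw [hθdef, ← Real.rpow_neg_one]
    exact Real.rpow_le_rpow_of_exponent_le hL1' (by linarith)
  obtain ⟨δW, CW, hδW, hCW, HW⟩ := fullProp_riemannMassW_unif (d := d) L hLodd hL ha hm0
  obtain ⟨δb, cb, hδb, hcb, Hb⟩ := constrainedProp_decay_blocks_unif (d + 1) L (by omega) ⟨hLodd, hL1⟩ ha hm0
  obtain ⟨Cr, κ, hCr, hκ, Hr⟩ := ksSlice_rate_unif (d := d) L hLodd hL ha hm0 hγ0 hγ1
  have hKb := latticeConst_nonneg (d + 1) (half_pos hδb).le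
  have hKκ := latticeConst_nonneg (d + 1) (half_pos hκ).le
  -- the weight window `δ₁ = min(min(1∕2, δ_W), min(δ_b∕2, κ∕2))` and the constant
  set δ₁ : ℝ := min (min (1 / 2) δW) (min (δb / 2) (κ / 2)) with hδ₁def
  have hδ₁ : 0 < δ₁ := lt_min (lt_min (by norm_num) hδW) (lt_min (half_pos hδb) (half_pos hκ))
  have hδ₁h : δ₁ ≤ 1 / 2 := (min_le_left _ _).trans (min_le_left _ _)
  have hδ₁W : δ₁ ≤ δW := (min_le_left _ _).trans (min_le_right _ _)
  have hδ₁b : δ₁ ≤ δb / 2 := (min_le_right _ _).trans (min_le_left _ _)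
  have hδ₁κ : δ₁ ≤ κ / 2 := (min_le_right _ _).trans (min_le_right _ _)
  set B₁ : ℝ := CW + (L : ℝ) ^ (d + 1) * cb * latticeConst (d + 1) (δb / 2) with hB₁def
  have hB₁ : 0 ≤ B₁ := by positivity
  set A : ℝ := B₁ * L + 2 * (Cr * latticeConst (d + 1) (κ / 2)) + 1 with hAdef
  have hA : 0 < A := by positivity
  -- numerical facts used in the step, proved once: `e^{δ₁} ≤ 2`, `2X ≤ A`, `3A ≤ AL`
  have he : Real.exp δ₁ ≤ 2 := by
    have e1 : Real.exp (1 / 2) * Real.exp (1 / 2) = Real.exp 1 := by rw [← Real.exp_add]; norm_num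
    have e2 : Real.exp (1 / 2) ≤ 2 := by nlinarith [Real.exp_pos (1 / 2 : ℝ), Real.exp_one_lt_d9]
    exact (Real.exp_le_exp.mpr hδ₁h).trans e2
  have hXA : 2 * (Cr * latticeConst (d + 1) (κ / 2)) ≤ A := by
    rw [hAdef]; linarith [mul_nonneg hB₁ hL0.le]
  have h3A : 3 * A ≤ A * L := by nlinarith [hA.le, hL3r]
  refine ⟨δ₁, A, hδ₁, hA, ?_⟩
  intro K hK
  induction K, hK using Nat.le_induction with
  | base =>
    intro δ' hδ0 hδ1 n hn e M _ hM msq hmsq hcap x'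
    set u := underPtN L 1 n M x' with hu
    have hNpos : (0 : ℝ) < (((L ^ n * L ^ 1 : ℕ) : ℝ)) ^ (d + 1) := by positivity
    -- the fine run: weighted mass of an `(1+n)`-level propagator at weight rate `δ′ ≤ δ_W` (part 11a); blocks of the points under = blocks of the points
    have hfine' := HW (1 + n) (by omega) δ' hδ0 (hδ1.trans hδ₁W) (L ^ n * L ^ 1) (by rw [pow_add, mul_comm]) e M hM msq hmsq hcap x'
    have hfine : ((((L ^ n * L ^ 1 : ℕ) : ℝ)) ^ (d + 1))⁻¹ *
        ∑ y', |constrainedProp (L ^ n * L ^ 1) M (aK a L (1 + n)) (((L ^ n * L ^ 1 : ℕ) : ℝ) ^ 2) msq x' y'|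
          * Real.exp (δ' * tdistT M (blockOf (L ^ 1) M u) (blockOf (L ^ 1) M (underPtN L 1 n M y'))) ≤ CW := by
      refine le_of_eq_of_le ?_ hfine'
      refine congrArg _ (sum_congr rfl fun y' _ => ?_)
      rw [hu, blockOf_underPtN L 1 n M x', blockOf_underPtN L 1 n M y']
    -- the coarse run: pointwise (1.10) with the weight absorbed (`δ′ ≤ δ_b∕2`)
    set P : Params := ⟨d + 1, L, e, 1, by omega, ⟨hLodd, hL1⟩⟩ with hPdef
    have hMK : ∀ μ, M μ = P.sitesPerDir P.K := fun μ => by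
      rw [hM μ]
      simp [hPdef, Params.sitesPerDir]
    have hpt : ∀ y' : Tor (fine (L ^ n * L ^ 1) M),
        |constrainedProp (L ^ 1) M (aK a L 1) (((L ^ 1 : ℕ) : ℝ) ^ 2) msq u (underPtN L 1 n M y')
            * Real.exp (δ' * tdistT M (blockOf (L ^ 1) M u) (blockOf (L ^ 1) M (underPtN L 1 n M y')))|
          ≤ (L : ℝ) ^ (d + 1) * cb * Real.exp (-(δb / 2 * tdistT M (blockOf (L ^ 1) M u) (blockOf (L ^ n * L ^ 1) M y'))) := by
      intro y'
      have h := Hb P rfl rfl le_rfl msq hmsq.le hcap M hMK (L ^ 1) rfl u (underPtN L 1 n M y')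
      have hcast : (((L ^ 1 : ℕ) : ℝ)) ^ P.d * cb = (L : ℝ) ^ (d + 1) * cb := by simp [hPdef]
      rw [hcast, blockOf_underPtN L 1 n M y'] at h
      rw [blockOf_underPtN L 1 n M y']
      exact abs_mul_exp_le_of_decay (by positivity) (hδ1.trans hδ₁b) (tdistT_nonneg _ _ _) h
    have hcoarse : ((((L ^ n * L ^ 1 : ℕ) : ℝ)) ^ (d + 1))⁻¹ *
          ∑ y', |constrainedProp (L ^ 1) M (aK a L 1) (((L ^ 1 : ℕ) : ℝ) ^ 2) msq u (underPtN L 1 n M y')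
            * Real.exp (δ' * tdistT M (blockOf (L ^ 1) M u) (blockOf (L ^ 1) M (underPtN L 1 n M y')))|
        ≤ (L : ℝ) ^ (d + 1) * cb * latticeConst (d + 1) (δb / 2) :=
      riemannSum_le_of_decay (L ^ n * L ^ 1) M (half_pos hδb) (by positivity) (blockOf (L ^ 1) M u) hpt
    have hθ1 : B₁ ≤ A * θ ^ 1 := by
      rw [pow_one]
      calc B₁ = B₁ * L * (L : ℝ)⁻¹ := by field_simp
        _ ≤ A * θ := mul_le_mul (by rw [hAdef]; linarith [mul_nonneg hCr.le hKκ]) hθL (inv_pos.mpr hL0).le hA.le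
    -- termwise: `|a − b|·w ≤ |a|·w + |b·w|`
    have hsplit : ∀ y' : Tor (fine (L ^ n * L ^ 1) M),
        |constrainedProp (L ^ n * L ^ 1) M (aK a L (1 + n)) (((L ^ n * L ^ 1 : ℕ) : ℝ) ^ 2) msq x' y'
            - constrainedProp (L ^ 1) M (aK a L 1) (((L ^ 1 : ℕ) : ℝ) ^ 2) msq u (underPtN L 1 n M y')|
            * Real.exp (δ' * tdistT M (blockOf (L ^ 1) M u) (blockOf (L ^ 1) M (underPtN L 1 n M y')))
          ≤ |constrainedProp (L ^ n * L ^ 1) M (aK a L (1 + n)) (((L ^ n * L ^ 1 : ℕ) : ℝ) ^ 2) msq x' y'|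
              * Real.exp (δ' * tdistT M (blockOf (L ^ 1) M u) (blockOf (L ^ 1) M (underPtN L 1 n M y')))
            + |constrainedProp (L ^ 1) M (aK a L 1) (((L ^ 1 : ℕ) : ℝ) ^ 2) msq u (underPtN L 1 n M y')
              * Real.exp (δ' * tdistT M (blockOf (L ^ 1) M u) (blockOf (L ^ 1) M (underPtN L 1 n M y')))| := by
      intro y'
      have hw := Real.exp_pos (δ' * tdistT M (blockOf (L ^ 1) M u) (blockOf (L ^ 1) M (underPtN L 1 n M y')))
      rw [abs_mul, abs_of_pos hw, ← add_mul]
      exact mul_le_mul_of_nonneg_right (abs_sub _ _) hw.le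
    calc _ ≤ ((((L ^ n * L ^ 1 : ℕ) : ℝ)) ^ (d + 1))⁻¹ *
            ∑ y', (|constrainedProp (L ^ n * L ^ 1) M (aK a L (1 + n)) (((L ^ n * L ^ 1 : ℕ) : ℝ) ^ 2) msq x' y'|
                * Real.exp (δ' * tdistT M (blockOf (L ^ 1) M u) (blockOf (L ^ 1) M (underPtN L 1 n M y')))
              + |constrainedProp (L ^ 1) M (aK a L 1) (((L ^ 1 : ℕ) : ℝ) ^ 2) msq u (underPtN L 1 n M y')
                * Real.exp (δ' * tdistT M (blockOf (L ^ 1) M u) (blockOf (L ^ 1) M (underPtN L 1 n M y')))|) :=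
          mul_le_mul_of_nonneg_left (sum_le_sum fun y' _ => hsplit y') (inv_nonneg.mpr hNpos.le)
      _ = ((((L ^ n * L ^ 1 : ℕ) : ℝ)) ^ (d + 1))⁻¹ *
              ∑ y', |constrainedProp (L ^ n * L ^ 1) M (aK a L (1 + n)) (((L ^ n * L ^ 1 : ℕ) : ℝ) ^ 2) msq x' y'|
                * Real.exp (δ' * tdistT M (blockOf (L ^ 1) M u) (blockOf (L ^ 1) M (underPtN L 1 n M y')))
            + ((((L ^ n * L ^ 1 : ℕ) : ℝ)) ^ (d + 1))⁻¹ *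
              ∑ y', |constrainedProp (L ^ 1) M (aK a L 1) (((L ^ 1 : ℕ) : ℝ) ^ 2) msq u (underPtN L 1 n M y')
                * Real.exp (δ' * tdistT M (blockOf (L ^ 1) M u) (blockOf (L ^ 1) M (underPtN L 1 n M y')))| := by
          rw [sum_add_distrib, mul_add]
      _ ≤ CW + (L : ℝ) ^ (d + 1) * cb * latticeConst (d + 1) (δb / 2) := add_le_add hfine hcoarse
      _ ≤ A * θ ^ 1 := hθ1
  | succ K hK IH =>
    intro δ' hδ0 hδ1 n hn e M _ hM msq hmsq hcap x''
    obtain rfl : M = fun _ => 2 * L ^ e := funext hM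
    set i : KSliceIdx d := ⟨e, K, hK, n, hn, 0, Nat.zero_le e, 1, le_rfl⟩ with hidef
    have h : ∀ μ, fine (L ^ n * L ^ K * L) (ksM L i) μ = fine (L ^ n * L ^ (K + 1)) (ksM L i) μ :=
      fine_assoc L K n (ksM L i)
    set E := (flatten (L ^ n * L ^ K) L (ksM L i)).trans (torCongr h) with hEdef
    obtain ⟨x', rfl⟩ := E.surjective x''
    set x := underPtN L K n (ksU L i) x' with hxdef
    have hL2pos : (0 : ℝ) < (L : ℝ) ^ 2 := by positivity
    have hm2 : 0 < msq / (L : ℝ) ^ 2 := div_pos hmsq hL2pos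
    have hm2cap : msq / (L : ℝ) ^ 2 ≤ m0sq := by
      have h1 : (1 : ℝ) ≤ (L : ℝ) ^ 2 := one_le_pow₀ hL1'
      exact (div_le_self hmsq.le h1).trans hcap
    have hM' : ∀ μ, ksU L i μ = 2 * L ^ (e + 1) := fun μ => by
      show L * (2 * L ^ e) = 2 * L ^ (e + 1)
      ring
    -- the weight rate one level down and the weight under the peel (blocks of the points under)
    have hδL0 : 0 ≤ δ' / L := div_nonneg hδ0 hL0.le
    have hδL1 : δ' / L ≤ δ₁ := (div_le_self hδ0 hL1').trans hδ1
    have hδLκ : δ' / L ≤ κ / 2 := hδL1.trans hδ₁κ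
    set W : Tor (fine (L ^ n * L ^ K) (ksU L i)) → ℝ := fun y' =>
      Real.exp (δ' / L * tdistT (ksU L i) (blockOf (L ^ K) (ksU L i) x) (blockOf (L ^ K) (ksU L i) (underPtN L K n (ksU L i) y')))
      with hWdef
    have hW0 : ∀ y', 0 ≤ W y' := fun y' => (Real.exp_pos _).le
    have hwt : ∀ y' : Tor (fine (L ^ n * L ^ K) (ksU L i)),
        Real.exp (δ' * tdistT (fun _ : Fin (d + 1) => 2 * L ^ e)
          (blockOf (L ^ (K + 1)) (fun _ : Fin (d + 1) => 2 * L ^ e) (flatten (L ^ K) L (ksM L i) x))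
          (blockOf (L ^ (K + 1)) (fun _ : Fin (d + 1) => 2 * L ^ e) (flatten (L ^ K) L (ksM L i) (underPtN L K n (ksU L i) y'))))
        ≤ Real.exp δ₁ * W y' := by
      intro y'
      rw [hWdef, ← Real.exp_add]
      apply Real.exp_le_exp.mpr
      have hBx : blockOf (L ^ (K + 1)) (fun _ : Fin (d + 1) => 2 * L ^ e) (flatten (L ^ K) L (ksM L i) x)
          = blockOf L (ksM L i) (blockOf (L ^ K) (ksU L i) x) := blockOf_flatten (L ^ K) L (ksM L i) x
      have hBy : blockOf (L ^ (K + 1)) (fun _ : Fin (d + 1) => 2 * L ^ e) (flatten (L ^ K) L (ksM L i) (underPtN L K n (ksU L i) y'))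
          = blockOf L (ksM L i) (blockOf (L ^ K) (ksU L i) (underPtN L K n (ksU L i) y')) :=
        blockOf_flatten (L ^ K) L (ksM L i) (underPtN L K n (ksU L i) y')
      have hgrow : (L : ℝ) * tdistT (fun _ : Fin (d + 1) => 2 * L ^ e)
          (blockOf (L ^ (K + 1)) (fun _ : Fin (d + 1) => 2 * L ^ e) (flatten (L ^ K) L (ksM L i) x))
          (blockOf (L ^ (K + 1)) (fun _ : Fin (d + 1) => 2 * L ^ e) (flatten (L ^ K) L (ksM L i) (underPtN L K n (ksU L i) y')))
          ≤ tdistT (ksU L i) (blockOf (L ^ K) (ksU L i) x) (blockOf (L ^ K) (ksU L i) (underPtN L K n (ksU L i) y')) + ((L : ℝ) - 1) := by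
        rw [hBx, hBy]
        exact mul_tdistT_blockOf_le L (ksM L i) _ _
      have hw := weight_peel_le hL1' hδ0 hδ1 hgrow
      linarith
    -- the induction hypothesis at the weight rate `δ′∕L` on the finer cube for the sub-pair
    have hIH : ((((L ^ n * L ^ K : ℕ) : ℝ)) ^ (d + 1))⁻¹ *
          ∑ y', |constrainedProp (L ^ n * L ^ K) (ksU L i) (aK a L (K + n)) (((L ^ n * L ^ K : ℕ) : ℝ) ^ 2)
              (msq / (L : ℝ) ^ 2) x' y'
            - constrainedProp (L ^ K) (ksU L i) (aK a L K) (((L ^ K : ℕ) : ℝ) ^ 2) (msq / (L : ℝ) ^ 2) x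
              (underPtN L K n (ksU L i) y')| * W y'
        ≤ A * θ ^ K :=
      IH (δ' / L) hδL0 hδL1 n hn (e + 1) (ksU L i) hM' (msq / (L : ℝ) ^ 2) hm2 hm2cap x'
    -- part M's slice rate with the weight absorbed (`δ′∕L ≤ κ∕2`)
    have hS : ((((L ^ n * L ^ K : ℕ) : ℝ)) ^ (d + 1))⁻¹ *
          ∑ y', |(ksSlice' L a (msq / (L : ℝ) ^ 2) i x' y' - ksSlice L a (msq / (L : ℝ) ^ 2) i x (underPtN L K n (ksU L i) y'))
            * W y'|
        ≤ Cr * θ ^ K * latticeConst (d + 1) (κ / 2) := by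
      refine riemannSum_le_of_decay (L ^ n * L ^ K) (ksU L i) (half_pos hκ) (by positivity) (blockOf (L ^ K) (ksU L i) x) fun y' => ?_
      have h1 := Hr (msq / (L : ℝ) ^ 2) hm2 hm2cap i x' y'
      have h2 := abs_mul_exp_le_of_decay (by positivity : 0 ≤ Cr * θ ^ K) hδLκ (tdistT_nonneg _ _ _) h1
      rw [blockOf_underPtN L K n (ksU L i) y'] at h2
      rw [hWdef]
      dsimp only
      rw [blockOf_underPtN L K n (ksU L i) y']
      exact h2
    have hNK : (0 : ℝ) < (((L ^ n * L ^ K : ℕ) : ℝ)) ^ (d + 1) := by positivity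
    have hcast : (((L ^ n * L ^ (K + 1) : ℕ) : ℝ)) ^ (d + 1) = (L : ℝ) ^ (d + 1) * (((L ^ n * L ^ K : ℕ) : ℝ)) ^ (d + 1) := by
      push_cast; ring
    have hsum : ∑ y'', |constrainedProp (L ^ n * L ^ (K + 1)) (fun _ : Fin (d + 1) => 2 * L ^ e) (aK a L (K + 1 + n))
            (((L ^ n * L ^ (K + 1) : ℕ) : ℝ) ^ 2) msq (E x') y''
          - constrainedProp (L ^ (K + 1)) (fun _ : Fin (d + 1) => 2 * L ^ e) (aK a L (K + 1))
            (((L ^ (K + 1) : ℕ) : ℝ) ^ 2) msq (underPtN L (K + 1) n (fun _ => 2 * L ^ e) (E x'))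
            (underPtN L (K + 1) n (fun _ => 2 * L ^ e) y'')|
          * Real.exp (δ' * tdistT (fun _ : Fin (d + 1) => 2 * L ^ e)
            (blockOf (L ^ (K + 1)) (fun _ : Fin (d + 1) => 2 * L ^ e) (underPtN L (K + 1) n (fun _ => 2 * L ^ e) (E x')))
            (blockOf (L ^ (K + 1)) (fun _ : Fin (d + 1) => 2 * L ^ e) (underPtN L (K + 1) n (fun _ => 2 * L ^ e) y'')))
        = ∑ y', |constrainedProp (L ^ n * L ^ (K + 1)) (ksM L i) (aK a L (K + 1 + n))
            (((L ^ n * L ^ (K + 1) : ℕ) : ℝ) ^ 2) msq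
            (torCongr h (flatten (L ^ n * L ^ K) L (ksM L i) x')) (torCongr h (flatten (L ^ n * L ^ K) L (ksM L i) y'))
          - constrainedProp (L ^ K * L) (ksM L i) (aK a L (K + 1)) (((L ^ K * L : ℕ) : ℝ) ^ 2) msq
            (flatten (L ^ K) L (ksM L i) x) (flatten (L ^ K) L (ksM L i) (underPtN L K n (ksU L i) y'))|
          * Real.exp (δ' * tdistT (fun _ : Fin (d + 1) => 2 * L ^ e)
            (blockOf (L ^ (K + 1)) (fun _ : Fin (d + 1) => 2 * L ^ e) (flatten (L ^ K) L (ksM L i) x))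
            (blockOf (L ^ (K + 1)) (fun _ : Fin (d + 1) => 2 * L ^ e) (flatten (L ^ K) L (ksM L i) (underPtN L K n (ksU L i) y')))) := by
      refine (Fintype.sum_equiv E _ _ fun y' => ?_).symm
      simp only [hEdef, Equiv.trans_apply]
      rw [underPtN_flatten L K n (ksM L i) h x', underPtN_flatten L K n (ksM L i) h y']
      rfl
    have hterm : ∀ y', |constrainedProp (L ^ n * L ^ (K + 1)) (ksM L i) (aK a L (K + 1 + n))
            (((L ^ n * L ^ (K + 1) : ℕ) : ℝ) ^ 2) msq
            (torCongr h (flatten (L ^ n * L ^ K) L (ksM L i) x')) (torCongr h (flatten (L ^ n * L ^ K) L (ksM L i) y'))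
          - constrainedProp (L ^ K * L) (ksM L i) (aK a L (K + 1)) (((L ^ K * L : ℕ) : ℝ) ^ 2) msq
            (flatten (L ^ K) L (ksM L i) x) (flatten (L ^ K) L (ksM L i) (underPtN L K n (ksU L i) y'))|
          * Real.exp (δ' * tdistT (fun _ : Fin (d + 1) => 2 * L ^ e)
            (blockOf (L ^ (K + 1)) (fun _ : Fin (d + 1) => 2 * L ^ e) (flatten (L ^ K) L (ksM L i) x))
            (blockOf (L ^ (K + 1)) (fun _ : Fin (d + 1) => 2 * L ^ e) (flatten (L ^ K) L (ksM L i) (underPtN L K n (ksU L i) y'))))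
        ≤ (L : ℝ) ^ (d + 1) / (L : ℝ) ^ 2 * Real.exp δ₁ *
          (|constrainedProp (L ^ n * L ^ K) (ksU L i) (aK a L (K + n)) (((L ^ n * L ^ K : ℕ) : ℝ) ^ 2)
                (msq / (L : ℝ) ^ 2) x' y'
              - constrainedProp (L ^ K) (ksU L i) (aK a L K) (((L ^ K : ℕ) : ℝ) ^ 2) (msq / (L : ℝ) ^ 2) x
                (underPtN L K n (ksU L i) y')| * W y'
            + |(ksSlice' L a (msq / (L : ℝ) ^ 2) i x' y' - ksSlice L a (msq / (L : ℝ) ^ 2) i x (underPtN L K n (ksU L i) y'))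
                * W y'|) := by
      intro y'
      have hp := fullProp_peel_pair_abs_le L hL ha hmsq i x' y' x (underPtN L K n (ksU L i) y') h
      have hSW : |(ksSlice' L a (msq / (L : ℝ) ^ 2) i x' y' - ksSlice L a (msq / (L : ℝ) ^ 2) i x (underPtN L K n (ksU L i) y'))
            * W y'| = |ksSlice' L a (msq / (L : ℝ) ^ 2) i x' y' - ksSlice L a (msq / (L : ℝ) ^ 2) i x (underPtN L K n (ksU L i) y')|
              * W y' := by
        rw [abs_mul, abs_of_nonneg (hW0 y')]
      rw [hSW]
      calc _ ≤ (L : ℝ) ^ (d + 1) / (L : ℝ) ^ 2 *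
            (|constrainedProp (L ^ n * L ^ K) (ksU L i) (aK a L (K + n)) (((L ^ n * L ^ K : ℕ) : ℝ) ^ 2)
                  (msq / (L : ℝ) ^ 2) x' y'
                - constrainedProp (L ^ K) (ksU L i) (aK a L K) (((L ^ K : ℕ) : ℝ) ^ 2) (msq / (L : ℝ) ^ 2) x
                  (underPtN L K n (ksU L i) y')|
              + |ksSlice' L a (msq / (L : ℝ) ^ 2) i x' y' - ksSlice L a (msq / (L : ℝ) ^ 2) i x (underPtN L K n (ksU L i) y')|)
            * (Real.exp δ₁ * W y') := mul_le_mul hp (hwt y') (Real.exp_pos _).le (by positivity)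
        _ = _ := by ring
    -- the gain: `L^{−2}e^{δ₁}(A + X)θ^K ≤ Aθ^{K+1}` because `e^{δ₁} ≤ 2`, `L ≥ 3`, `θ ≥ L^{−1}`, `A ≥ 2X`
    have hgain : ((L : ℝ) ^ 2)⁻¹ * Real.exp δ₁ * (A * θ ^ K + Cr * θ ^ K * latticeConst (d + 1) (κ / 2)) ≤ A * θ ^ (K + 1) := by
      have hX := mul_nonneg hCr.le hKκ
      have h1 : Real.exp δ₁ * (A + Cr * latticeConst (d + 1) (κ / 2)) ≤ A * L := by
        calc Real.exp δ₁ * (A + Cr * latticeConst (d + 1) (κ / 2)) ≤ 2 * (A + Cr * latticeConst (d + 1) (κ / 2)) :=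
              mul_le_mul_of_nonneg_right he (by positivity)
          _ ≤ A * L := by linarith
      have h2 : ((L : ℝ) ^ 2)⁻¹ * Real.exp δ₁ * (A + Cr * latticeConst (d + 1) (κ / 2)) ≤ A * θ := by
        calc ((L : ℝ) ^ 2)⁻¹ * Real.exp δ₁ * (A + Cr * latticeConst (d + 1) (κ / 2))
            = ((L : ℝ) ^ 2)⁻¹ * (Real.exp δ₁ * (A + Cr * latticeConst (d + 1) (κ / 2))) := by ring
          _ ≤ ((L : ℝ) ^ 2)⁻¹ * (A * L) := mul_le_mul_of_nonneg_left h1 (by positivity)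
          _ = A * (L : ℝ)⁻¹ := by field_simp
          _ ≤ A * θ := mul_le_mul_of_nonneg_left hθL hA.le
      calc ((L : ℝ) ^ 2)⁻¹ * Real.exp δ₁ * (A * θ ^ K + Cr * θ ^ K * latticeConst (d + 1) (κ / 2))
          = ((L : ℝ) ^ 2)⁻¹ * Real.exp δ₁ * (A + Cr * latticeConst (d + 1) (κ / 2)) * θ ^ K := by ring
        _ ≤ A * θ * θ ^ K := mul_le_mul_of_nonneg_right h2 (pow_nonneg hθ0.le K)
        _ = A * θ ^ (K + 1) := by rw [pow_succ]; ring
    calc ((((L ^ n * L ^ (K + 1) : ℕ) : ℝ)) ^ (d + 1))⁻¹ *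
            ∑ y'', |constrainedProp (L ^ n * L ^ (K + 1)) (fun _ : Fin (d + 1) => 2 * L ^ e) (aK a L (K + 1 + n))
                (((L ^ n * L ^ (K + 1) : ℕ) : ℝ) ^ 2) msq (E x') y''
              - constrainedProp (L ^ (K + 1)) (fun _ : Fin (d + 1) => 2 * L ^ e) (aK a L (K + 1))
                (((L ^ (K + 1) : ℕ) : ℝ) ^ 2) msq (underPtN L (K + 1) n (fun _ => 2 * L ^ e) (E x'))
                (underPtN L (K + 1) n (fun _ => 2 * L ^ e) y'')|
              * Real.exp (δ' * tdistT (fun _ : Fin (d + 1) => 2 * L ^ e)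
                (blockOf (L ^ (K + 1)) (fun _ : Fin (d + 1) => 2 * L ^ e) (underPtN L (K + 1) n (fun _ => 2 * L ^ e) (E x')))
                (blockOf (L ^ (K + 1)) (fun _ : Fin (d + 1) => 2 * L ^ e) (underPtN L (K + 1) n (fun _ => 2 * L ^ e) y'')))
        ≤ ((((L ^ n * L ^ (K + 1) : ℕ) : ℝ)) ^ (d + 1))⁻¹ * ∑ y', (L : ℝ) ^ (d + 1) / (L : ℝ) ^ 2 * Real.exp δ₁ *
            (|constrainedProp (L ^ n * L ^ K) (ksU L i) (aK a L (K + n)) (((L ^ n * L ^ K : ℕ) : ℝ) ^ 2)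
                  (msq / (L : ℝ) ^ 2) x' y'
                - constrainedProp (L ^ K) (ksU L i) (aK a L K) (((L ^ K : ℕ) : ℝ) ^ 2) (msq / (L : ℝ) ^ 2) x
                  (underPtN L K n (ksU L i) y')| * W y'
              + |(ksSlice' L a (msq / (L : ℝ) ^ 2) i x' y' - ksSlice L a (msq / (L : ℝ) ^ 2) i x (underPtN L K n (ksU L i) y'))
                  * W y'|) := by
          rw [hsum]
          exact mul_le_mul_of_nonneg_left (sum_le_sum fun y' _ => hterm y') (by positivity)
      _ = ((L : ℝ) ^ 2)⁻¹ * Real.exp δ₁ *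
            (((((L ^ n * L ^ K : ℕ) : ℝ)) ^ (d + 1))⁻¹ *
                ∑ y', |constrainedProp (L ^ n * L ^ K) (ksU L i) (aK a L (K + n)) (((L ^ n * L ^ K : ℕ) : ℝ) ^ 2)
                    (msq / (L : ℝ) ^ 2) x' y'
                  - constrainedProp (L ^ K) (ksU L i) (aK a L K) (((L ^ K : ℕ) : ℝ) ^ 2) (msq / (L : ℝ) ^ 2) x
                    (underPtN L K n (ksU L i) y')| * W y'
              + ((((L ^ n * L ^ K : ℕ) : ℝ)) ^ (d + 1))⁻¹ *
                ∑ y', |(ksSlice' L a (msq / (L : ℝ) ^ 2) i x' y'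
                  - ksSlice L a (msq / (L : ℝ) ^ 2) i x (underPtN L K n (ksU L i) y')) * W y'|) := by
          rw [hcast, ← mul_sum, sum_add_distrib]
          field_simp
          ring
      _ ≤ ((L : ℝ) ^ 2)⁻¹ * Real.exp δ₁ * (A * θ ^ K + Cr * θ ^ K * latticeConst (d + 1) (κ / 2)) :=
          mul_le_mul_of_nonneg_left (add_le_add hIH hS) (by positivity)
      _ ≤ A * θ ^ (K + 1) := hgain

end RateW

end Summit.QuantumFields.YangMills.BalabanUVNodes.N15.KingModel

end
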